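import Mathlib
import HarnessLib

/-!
# LatticeQCDFlow / Scoring — pairs, triples and quadruples of independent identically distributed
# draws on a GENERAL measurable space: joint laws, and the partner-pair moments of a
# square-integrable symmetric kernel (`μ_F`, `c₂`, `c₁`, `μ_F²`)

HONEST FRAMING: exact (Metropolis-corrected) sampling algorithms for lattice gauge theory;
figures of merit are autocorrelation/cost numbers at stated couplings and volumes; no
continuum-physics claim.

Venture `LatticeQCDFlow` (cell pub-lqcd), sub-topic `Scoring`; FANOUT row 3 (`s0-u1-a`, S0-B
implementation A, GEN-10).  The MEASURE-THEORETIC toolkit behind the general-space form of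
Hoeffding's variance decomposition (`Scoring/UStatisticVarianceIntegral`, which imports this file)
— the partner-pair bookkeeping of row 3's finite `Scoring/UStatisticVariance` (GEN-8), redone on an
abstract probability space.  Elementary consequences of Mathlib's independence API
(`iIndepFun.indepFun_prodMk`, `iIndepFun.indepFun_prodMk_prodMk`,
`indepFun_iff_map_prod_eq_prod_map_map`, `IndepFun.integral_fun_mul_eq_mul_integral`) and Fubini
(`integral_prod`, `integral_prod_mul`); [folklore] throughout; NO definition is introduced.
The setting is the one of row 4's `Scoring/AllPairsAcceptance` and of the tree's
`Literature.Probability.Moments.UStatisticHoeffding`: an abstract probability space `(Ω, P)`,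
draws `x i : Ω → X` (`i : Fin n`) into ANY measurable space, mutually independent (`iIndepFun`)
with a common law `ν` (`P ∘ (x i)⁻¹ = ν`), and a symmetric kernel `F` that is merely
SQUARE-INTEGRABLE under `ν ⊗ ν` (no boundedness, no weight ceiling).

## Content (`μ_F = ∫ F d(ν⊗ν)`, `h(a) = ∫ F(a, b) dν(b)`, `c₁ = ∫ h² dν`, `c₂ = ∫ F² d(ν⊗ν)`)

* §1 laws: `map_pair_eq_prod_iid` (`P ∘ (x_i, x_j)⁻¹ = ν ⊗ ν` for `i ≠ j`),
  `map_triple_eq_prod_iid` (`ν ⊗ (ν ⊗ ν)`), `map_quad_eq_prod_iid` (`(ν ⊗ ν) ⊗ (ν ⊗ ν)`);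
* §2 dictionary: `integral_comp_pair_iid`, `memLp_comp_pair_iid`, `integral_comp_triple_iid`,
  `integrable_comp_triple_iid_iff`;
* §3 partner-pair moments of `F ∈ L²(ν ⊗ ν)`: `memLp_kernel_iid`, `integrable_kernel_mul_kernel_iid`
  (Cauchy–Schwarz), `integral_kernel_iid` (`μ_F`: unbiasedness of every pair),
  `integral_kernel_mul_self_iid` / `integral_kernel_mul_swap_iid` (`c₂`),
  **`integral_kernel_mul_kernel_shared_iid`** / `…_of_shared_iid` (`c₁`: condition on the shared
  draw — the law of `(x_i, (x_j, x_k))` is `ν ⊗ (ν ⊗ ν)`, Fubini, `∫ f(b)g(c) d(ν⊗ν) = ∫f·∫g`),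
  **`integral_kernel_mul_kernel_disjoint_iid`** (`μ_F²`: the two pairs are independent).

NOT CLAIMED: non-identically distributed draws; kernels of more than two arguments; nothing about
any statistic of ours.
-/

namespace Summit.Ventures.LatticeQCDFlow.Scoring

open MeasureTheory ProbabilityTheory Finset

section IID

variable {Ω : Type*} [MeasurableSpace Ω] {P : Measure Ω} [IsProbabilityMeasure P]
variable {X : Type*} [MeasurableSpace X] {ν : Measure X}
variable {n : ℕ} {x : Fin n → Ω → X}

/-! ### §1 The laws of pairs, triples and quadruples of independent draws -/

omit [IsProbabilityMeasure P] in
/-- The common law of the draws of a probability space is a probability measure. [folklore] -/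
theorem isProbabilityMeasure_of_map_eq_iid [IsProbabilityMeasure P] {i : Fin n}
    (hxm : Measurable (x i)) (hlaw : Measure.map (x i) P = ν) : IsProbabilityMeasure ν := by
  rw [← hlaw]
  exact Measure.isProbabilityMeasure_map hxm.aemeasurable

/-- **Two distinct independent draws with common law `ν` have joint law `ν ⊗ ν`.** [folklore] -/
theorem map_pair_eq_prod_iid (hxm : ∀ i, Measurable (x i)) (hind : iIndepFun x P)
    (hlaw : ∀ i, Measure.map (x i) P = ν) {i j : Fin n} (hij : i ≠ j) :
    Measure.map (fun ω => (x i ω, x j ω)) P = ν.prod ν := by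
  rw [(indepFun_iff_map_prod_eq_prod_map_map (hxm i).aemeasurable (hxm j).aemeasurable).1
    (hind.indepFun hij), hlaw i, hlaw j]

/-- **Three pairwise distinct independent draws have joint law `ν ⊗ (ν ⊗ ν)`.** [folklore] -/
theorem map_triple_eq_prod_iid (hxm : ∀ i, Measurable (x i)) (hind : iIndepFun x P)
    (hlaw : ∀ i, Measure.map (x i) P = ν) {i j k : Fin n} (hij : i ≠ j) (hik : i ≠ k)
    (hjk : j ≠ k) :
    Measure.map (fun ω => (x i ω, (x j ω, x k ω))) P = ν.prod (ν.prod ν) := by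
  have h : IndepFun (x i) (fun ω => (x j ω, x k ω)) P :=
    (hind.indepFun_prodMk hxm j k i hij.symm hik.symm).symm
  rw [(indepFun_iff_map_prod_eq_prod_map_map (hxm i).aemeasurable
      ((hxm j).prodMk (hxm k)).aemeasurable).1 h, map_pair_eq_prod_iid hxm hind hlaw hjk, hlaw i]

/-- **Two disjoint pairs of distinct independent draws have joint law `(ν ⊗ ν) ⊗ (ν ⊗ ν)`.**
[folklore] -/
theorem map_quad_eq_prod_iid (hxm : ∀ i, Measurable (x i)) (hind : iIndepFun x P)
    (hlaw : ∀ i, Measure.map (x i) P = ν) {i j k l : Fin n} (hij : i ≠ j) (hkl : k ≠ l)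
    (hik : i ≠ k) (hil : i ≠ l) (hjk : j ≠ k) (hjl : j ≠ l) :
    Measure.map (fun ω => ((x i ω, x j ω), (x k ω, x l ω))) P = (ν.prod ν).prod (ν.prod ν) := by
  have h : IndepFun (fun ω => (x i ω, x j ω)) (fun ω => (x k ω, x l ω)) P :=
    hind.indepFun_prodMk_prodMk hxm i j k l hik hil hjk hjl
  rw [(indepFun_iff_map_prod_eq_prod_map_map ((hxm i).prodMk (hxm j)).aemeasurable
      ((hxm k).prodMk (hxm l)).aemeasurable).1 h, map_pair_eq_prod_iid hxm hind hlaw hij,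
    map_pair_eq_prod_iid hxm hind hlaw hkl]

/-! ### §2 Dictionary: expectations of functions of a pair / a triple of draws -/

/-- **Pair dictionary**: for `i ≠ j` and `G` a.e.-strongly measurable under `ν ⊗ ν`,
`∫ G(x_i, x_j) dP = ∫ G d(ν ⊗ ν)`. [folklore] -/
theorem integral_comp_pair_iid (hxm : ∀ i, Measurable (x i)) (hind : iIndepFun x P)
    (hlaw : ∀ i, Measure.map (x i) P = ν) {i j : Fin n} (hij : i ≠ j) {G : X × X → ℝ}
    (hG : AEStronglyMeasurable G (ν.prod ν)) :
    ∫ ω, G (x i ω, x j ω) ∂P = ∫ z, G z ∂(ν.prod ν) := by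
  rw [← map_pair_eq_prod_iid hxm hind hlaw hij] at hG ⊢
  exact (integral_map ((hxm i).prodMk (hxm j)).aemeasurable hG).symm

/-- **Pair dictionary, `Lᵖ`**: for `i ≠ j`, `G ∈ Lᵖ(ν ⊗ ν)` ⇒ `G(x_i, x_j) ∈ Lᵖ(P)`. [folklore] -/
theorem memLp_comp_pair_iid (hxm : ∀ i, Measurable (x i)) (hind : iIndepFun x P)
    (hlaw : ∀ i, Measure.map (x i) P = ν) {i j : Fin n} (hij : i ≠ j) {G : X × X → ℝ}
    {p : ENNReal} (hG : MemLp G p (ν.prod ν)) :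
    MemLp (fun ω => G (x i ω, x j ω)) p P := by
  rw [← map_pair_eq_prod_iid hxm hind hlaw hij] at hG
  exact hG.comp_of_map ((hxm i).prodMk (hxm j)).aemeasurable

/-- **Triple dictionary**: for pairwise distinct `i, j, k` and `G` a.e.-strongly measurable under
`ν ⊗ (ν ⊗ ν)`, `∫ G(x_i, (x_j, x_k)) dP = ∫ G d(ν ⊗ (ν ⊗ ν))`. [folklore] -/
theorem integral_comp_triple_iid (hxm : ∀ i, Measurable (x i)) (hind : iIndepFun x P)
    (hlaw : ∀ i, Measure.map (x i) P = ν) {i j k : Fin n} (hij : i ≠ j) (hik : i ≠ k)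
    (hjk : j ≠ k) {G : X × (X × X) → ℝ} (hG : AEStronglyMeasurable G (ν.prod (ν.prod ν))) :
    ∫ ω, G (x i ω, (x j ω, x k ω)) ∂P = ∫ t, G t ∂(ν.prod (ν.prod ν)) := by
  rw [← map_triple_eq_prod_iid hxm hind hlaw hij hik hjk] at hG ⊢
  exact (integral_map ((hxm i).prodMk ((hxm j).prodMk (hxm k))).aemeasurable hG).symm

/-- **Triple dictionary, integrability**: for pairwise distinct `i, j, k` and measurable `G`,
`G(x_i, (x_j, x_k))` is `P`-integrable iff `G` is `ν ⊗ (ν ⊗ ν)`-integrable. [folklore] -/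
theorem integrable_comp_triple_iid_iff (hxm : ∀ i, Measurable (x i)) (hind : iIndepFun x P)
    (hlaw : ∀ i, Measure.map (x i) P = ν) {i j k : Fin n} (hij : i ≠ j) (hik : i ≠ k)
    (hjk : j ≠ k) {G : X × (X × X) → ℝ} (hG : Measurable G) :
    Integrable (fun ω => G (x i ω, (x j ω, x k ω))) P ↔ Integrable G (ν.prod (ν.prod ν)) := by
  rw [← map_triple_eq_prod_iid hxm hind hlaw hij hik hjk,
    integrable_map_measure hG.aestronglyMeasurable
      ((hxm i).prodMk ((hxm j).prodMk (hxm k))).aemeasurable]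
  rfl

/-! ### §3 Partner-pair moments of a square-integrable symmetric kernel -/

/-- `F(x_i, x_j) ∈ L²(P)` for `i ≠ j` when `F ∈ L²(ν ⊗ ν)`. [folklore] -/
theorem memLp_kernel_iid (hxm : ∀ i, Measurable (x i)) (hind : iIndepFun x P)
    (hlaw : ∀ i, Measure.map (x i) P = ν) {F : X → X → ℝ}
    (hF2 : MemLp (fun z : X × X => F z.1 z.2) 2 (ν.prod ν)) {i j : Fin n} (hij : i ≠ j) :
    MemLp (fun ω => F (x i ω) (x j ω)) 2 P :=
  memLp_comp_pair_iid hxm hind hlaw hij (G := fun z : X × X => F z.1 z.2) hF2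

/-- `F(x_i, x_j)` is `P`-integrable for `i ≠ j` when `F ∈ L²(ν ⊗ ν)`. [folklore] -/
theorem integrable_kernel_iid (hxm : ∀ i, Measurable (x i)) (hind : iIndepFun x P)
    (hlaw : ∀ i, Measure.map (x i) P = ν) {F : X → X → ℝ}
    (hF2 : MemLp (fun z : X × X => F z.1 z.2) 2 (ν.prod ν)) {i j : Fin n} (hij : i ≠ j) :
    Integrable (fun ω => F (x i ω) (x j ω)) P :=
  (memLp_kernel_iid hxm hind hlaw hF2 hij).integrable one_le_two

/-- The product of two kernel terms (along any two ordered pairs of distinct indices) is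
`P`-integrable when `F ∈ L²(ν ⊗ ν)` (Cauchy–Schwarz). [folklore] -/
theorem integrable_kernel_mul_kernel_iid (hxm : ∀ i, Measurable (x i)) (hind : iIndepFun x P)
    (hlaw : ∀ i, Measure.map (x i) P = ν) {F : X → X → ℝ}
    (hF2 : MemLp (fun z : X × X => F z.1 z.2) 2 (ν.prod ν)) {i j k l : Fin n} (hij : i ≠ j)
    (hkl : k ≠ l) :
    Integrable (fun ω => F (x i ω) (x j ω) * F (x k ω) (x l ω)) P :=
  (memLp_kernel_iid hxm hind hlaw hF2 hij).integrable_mul (memLp_kernel_iid hxm hind hlaw hF2 hkl)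

/-- **Unbiasedness of every pair**: `∫ F(x_i, x_j) dP = ∫ F d(ν ⊗ ν) = μ_F` for `i ≠ j`.
[folklore] -/
theorem integral_kernel_iid (hxm : ∀ i, Measurable (x i)) (hind : iIndepFun x P)
    (hlaw : ∀ i, Measure.map (x i) P = ν) {F : X → X → ℝ}
    (hFm : Measurable fun z : X × X => F z.1 z.2) {i j : Fin n} (hij : i ≠ j) :
    ∫ ω, F (x i ω) (x j ω) ∂P = ∫ z, F z.1 z.2 ∂(ν.prod ν) :=
  integral_comp_pair_iid hxm hind hlaw hij (G := fun z : X × X => F z.1 z.2)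
    hFm.aestronglyMeasurable

/-- **The coincident partner contributes `c₂ = ∫ F² d(ν ⊗ ν)`.** [folklore] -/
theorem integral_kernel_mul_self_iid (hxm : ∀ i, Measurable (x i)) (hind : iIndepFun x P)
    (hlaw : ∀ i, Measure.map (x i) P = ν) {F : X → X → ℝ}
    (hFm : Measurable fun z : X × X => F z.1 z.2) {i j : Fin n} (hij : i ≠ j) :
    ∫ ω, F (x i ω) (x j ω) * F (x i ω) (x j ω) ∂P = ∫ z, F z.1 z.2 ^ 2 ∂(ν.prod ν) :=
  calc ∫ ω, F (x i ω) (x j ω) * F (x i ω) (x j ω) ∂P = ∫ ω, F (x i ω) (x j ω) ^ 2 ∂P :=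
      integral_congr_ae (Filter.Eventually.of_forall fun ω => by simp only [sq])
    _ = ∫ z, F z.1 z.2 ^ 2 ∂(ν.prod ν) :=
      integral_comp_pair_iid hxm hind hlaw hij (G := fun z : X × X => F z.1 z.2 ^ 2)
        (hFm.pow_const 2).aestronglyMeasurable

/-- **The swapped partner contributes `c₂`** as well, for a symmetric kernel. [folklore] -/
theorem integral_kernel_mul_swap_iid (hxm : ∀ i, Measurable (x i)) (hind : iIndepFun x P)
    (hlaw : ∀ i, Measure.map (x i) P = ν) {F : X → X → ℝ}
    (hFm : Measurable fun z : X × X => F z.1 z.2) (hF : ∀ a b, F a b = F b a) {i j : Fin n}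
    (hij : i ≠ j) :
    ∫ ω, F (x i ω) (x j ω) * F (x j ω) (x i ω) ∂P = ∫ z, F z.1 z.2 ^ 2 ∂(ν.prod ν) :=
  calc ∫ ω, F (x i ω) (x j ω) * F (x j ω) (x i ω) ∂P
      = ∫ ω, F (x i ω) (x j ω) * F (x i ω) (x j ω) ∂P :=
        integral_congr_ae (Filter.Eventually.of_forall fun ω => by simp only [hF (x j ω) (x i ω)])
    _ = ∫ z, F z.1 z.2 ^ 2 ∂(ν.prod ν) := integral_kernel_mul_self_iid hxm hind hlaw hFm hij

/-- **A partner pair sharing exactly one index contributes `c₁ = ∫ h² dν`**: for pairwise distinct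
`i, j, k`, `∫ F(x_i, x_j)·F(x_i, x_k) dP = ∫ (∫ F(a, b) dν(b))² dν(a)` — condition on the shared
draw: the law of `(x_i, (x_j, x_k))` is `ν ⊗ (ν ⊗ ν)`, Fubini, and `∫ f(b)g(c) d(ν⊗ν) = ∫f·∫g`.
[folklore] -/
theorem integral_kernel_mul_kernel_shared_iid (hxm : ∀ i, Measurable (x i)) (hind : iIndepFun x P)
    (hlaw : ∀ i, Measure.map (x i) P = ν) {F : X → X → ℝ}
    (hFm : Measurable fun z : X × X => F z.1 z.2)
    (hF2 : MemLp (fun z : X × X => F z.1 z.2) 2 (ν.prod ν)) {i j k : Fin n} (hij : i ≠ j)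
    (hik : i ≠ k) (hjk : j ≠ k) :
    ∫ ω, F (x i ω) (x j ω) * F (x i ω) (x k ω) ∂P = ∫ a, (∫ b, F a b ∂ν) ^ 2 ∂ν := by
  haveI := isProbabilityMeasure_of_map_eq_iid (hxm i) (hlaw i)
  have hGm : Measurable fun t : X × (X × X) => F t.1 t.2.1 * F t.1 t.2.2 :=
    (hFm.comp (measurable_fst.prodMk measurable_snd.fst)).mul
      (hFm.comp (measurable_fst.prodMk measurable_snd.snd))
  have hI : Integrable (fun t : X × (X × X) => F t.1 t.2.1 * F t.1 t.2.2) (ν.prod (ν.prod ν)) :=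
    (integrable_comp_triple_iid_iff hxm hind hlaw hij hik hjk hGm).1
      (integrable_kernel_mul_kernel_iid hxm hind hlaw hF2 hij hik)
  calc ∫ ω, F (x i ω) (x j ω) * F (x i ω) (x k ω) ∂P
      = ∫ t, F t.1 t.2.1 * F t.1 t.2.2 ∂(ν.prod (ν.prod ν)) :=
        integral_comp_triple_iid hxm hind hlaw hij hik hjk
          (G := fun t : X × (X × X) => F t.1 t.2.1 * F t.1 t.2.2) hGm.aestronglyMeasurable
    _ = ∫ a, ∫ bc : X × X, F a bc.1 * F a bc.2 ∂(ν.prod ν) ∂ν := integral_prod _ hI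
    _ = ∫ a, (∫ b, F a b ∂ν) ^ 2 ∂ν := by
        refine integral_congr_ae (Filter.Eventually.of_forall fun a => ?_)
        simp only
        rw [integral_prod_mul (fun b => F a b) (fun c => F a c), sq]

/-- The four positions in which an ordered pair `(k, l)` can share exactly one index with `(i, j)`,
reduced to `integral_kernel_mul_kernel_shared_iid` by the symmetry of the kernel. [folklore] -/
theorem integral_kernel_mul_kernel_of_shared_iid (hxm : ∀ i, Measurable (x i))
    (hind : iIndepFun x P) (hlaw : ∀ i, Measure.map (x i) P = ν) {F : X → X → ℝ}
    (hFm : Measurable fun z : X × X => F z.1 z.2) (hF : ∀ a b, F a b = F b a)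
    (hF2 : MemLp (fun z : X × X => F z.1 z.2) 2 (ν.prod ν)) {i j k l : Fin n} (hij : i ≠ j)
    (hkl : k ≠ l) (hshare : k = i ∨ k = j ∨ l = i ∨ l = j) (hne : ¬(k = i ∧ l = j))
    (hne' : ¬(k = j ∧ l = i)) :
    ∫ ω, F (x i ω) (x j ω) * F (x k ω) (x l ω) ∂P = ∫ a, (∫ b, F a b ∂ν) ^ 2 ∂ν := by
  rcases hshare with hk | hk | hl | hl
  · -- `k = i`: shared index `i`, the others `j`, `l`
    rw [hk]
    exact integral_kernel_mul_kernel_shared_iid hxm hind hlaw hFm hF2 hij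
      (fun h => hkl (hk.trans h)) (fun h => hne ⟨hk, h.symm⟩)
  · -- `k = j`: shared index `j`, the others `i`, `l`
    rw [hk]
    calc ∫ ω, F (x i ω) (x j ω) * F (x j ω) (x l ω) ∂P
        = ∫ ω, F (x j ω) (x i ω) * F (x j ω) (x l ω) ∂P :=
          integral_congr_ae (Filter.Eventually.of_forall fun ω => by simp only [hF (x i ω) (x j ω)])
      _ = _ := integral_kernel_mul_kernel_shared_iid hxm hind hlaw hFm hF2 hij.symm
          (fun h => hkl (hk.trans h)) (fun h => hne' ⟨hk, h.symm⟩)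
  · -- `l = i`: shared index `i`, the others `j`, `k`
    rw [hl]
    calc ∫ ω, F (x i ω) (x j ω) * F (x k ω) (x i ω) ∂P
        = ∫ ω, F (x i ω) (x j ω) * F (x i ω) (x k ω) ∂P :=
          integral_congr_ae (Filter.Eventually.of_forall fun ω => by simp only [hF (x k ω) (x i ω)])
      _ = _ := integral_kernel_mul_kernel_shared_iid hxm hind hlaw hFm hF2 hij
          (fun h => hkl (h.symm.trans hl.symm)) (fun h => hne' ⟨h.symm, hl⟩)
  · -- `l = j`: shared index `j`, the others `i`, `k`
    rw [hl]
    calc ∫ ω, F (x i ω) (x j ω) * F (x k ω) (x j ω) ∂P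
        = ∫ ω, F (x j ω) (x i ω) * F (x j ω) (x k ω) ∂P :=
          integral_congr_ae (Filter.Eventually.of_forall fun ω => by
            simp only [hF (x i ω) (x j ω), hF (x k ω) (x j ω)])
      _ = _ := integral_kernel_mul_kernel_shared_iid hxm hind hlaw hFm hF2 hij.symm
          (fun h => hkl (h.symm.trans hl.symm)) (fun h => hne ⟨h.symm, hl⟩)

/-- **A disjoint partner pair contributes `μ_F²`**: for pairwise distinct `i, j, k, l`,
`∫ F(x_i, x_j)·F(x_k, x_l) dP = (∫ F d(ν ⊗ ν))²` (the two pairs are independent). [folklore] -/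
theorem integral_kernel_mul_kernel_disjoint_iid (hxm : ∀ i, Measurable (x i))
    (hind : iIndepFun x P) (hlaw : ∀ i, Measure.map (x i) P = ν) {F : X → X → ℝ}
    (hFm : Measurable fun z : X × X => F z.1 z.2)
    (hF2 : MemLp (fun z : X × X => F z.1 z.2) 2 (ν.prod ν)) {i j k l : Fin n} (hij : i ≠ j)
    (hkl : k ≠ l) (hik : i ≠ k) (hil : i ≠ l) (hjk : j ≠ k) (hjl : j ≠ l) :
    ∫ ω, F (x i ω) (x j ω) * F (x k ω) (x l ω) ∂P = (∫ z, F z.1 z.2 ∂(ν.prod ν)) ^ 2 := by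
  have h : IndepFun (fun ω => F (x i ω) (x j ω)) (fun ω => F (x k ω) (x l ω)) P :=
    (hind.indepFun_prodMk_prodMk hxm i j k l hik hil hjk hjl).comp hFm hFm
  rw [h.integral_fun_mul_eq_mul_integral (memLp_kernel_iid hxm hind hlaw hF2 hij).1
      (memLp_kernel_iid hxm hind hlaw hF2 hkl).1]
  change (∫ ω, F (x i ω) (x j ω) ∂P) * (∫ ω, F (x k ω) (x l ω) ∂P) = _
  rw [integral_kernel_iid hxm hind hlaw hFm hij, integral_kernel_iid hxm hind hlaw hFm hkl, sq]

end IID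

end Summit.Ventures.LatticeQCDFlow.Scoring
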